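import Summits.ResolutionOfSingularities.ResolutionOfSingularities.Theorems.HilbertSamuelEliminationSigmaMaxModificationsCorridor3SigmaTameLowSncContact
import Mathlib.RingTheory.Polynomial.ScaleRoots
import HarnessLib

/-!
# [OURS · L1 W4.2] TAME-LOW row T-L4 «SNC PHASE, lineage-local» — part 4a (singular-branch half): the strict transform of an
# arbitrary branch `f` (order `m`) on the chart `R[y/x]`, and the chart of the branch: the ring map `R[y/x] → L` over a point
# `θ : R → L` of the branch (`ker θ = (f)`, `θ x ≠ 0`), whose kernel is generated by the strict transform `f/xᵐ`
# (cell res-hironaka, LADDER-RESOLUTION rung L; slot W4.2, crux chain w42 `SigmaMaxModificationsCorridor3` stmt-ResolutionOfSingularities-19249 /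
# crux `SigmaMaxModifications` stmt-…-18506; res-L1-w42-plan-1 RULING v3.14-48 (PD)(iv)/(PF) row T-L4 → res-L1-w42-stub-4 (gen 7);
# `--supports stmt-ResolutionOfSingularities-19249 --as helper`; consumer: part 4b (the strict transform of a branch at a point `R₁` of the
# blow-up is a QUADRATIC TRANSFORM OF THE BRANCH, so the tree's `δ`-drop `IsQuadraticTransform.curveDelta_lt` applies))

HONEST FRAMING.  OURS bookkeeping for the TAME-LOW tier (RULING v3.14-48 (PD)(iv)): Herrmann–Ikeda–Orbanz Ch. II / Thm. (30.2) «the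
strict transform of `V(𝔭)` in the chart is the chart of the blow-up of `R/𝔭`», in the `Subring K` chart currency `chartAdjoin x y = R[y/x]`
of `QuadraticTransformWeakTransform.lean` (the tree's `QuadraticTransformAlongPrime.lean` proves the same for the abstract Rees chart
`chartRing`; here we need it for the subring chart that carries `IsQuadraticTransform`). Nothing here is a statement of H. Hironaka's
manuscript [Hironaka2017] (CANDIDATE, never a premise) nor of Cossart–Jannsen–Saito; no named fact; every theorem PROVED. AI-written;
weaker than expert review.

SETTING.  `R ⊆ K` a local ring with `𝔪_R = (x, y)`, `x ≠ 0`; `A = chartAdjoin x y = R[y/x] ⊆ K` with `chartIncl : R → A`; a field `L`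
and a ring map `θ : R → L` with `θ x ≠ 0` («a point of `Spec R` off `V(x)` with values in `L`»; for a branch `f`: `L = Frac(R/(f))`,
`ker θ = (f)`).

* `div_pow_mem_chartAdjoin` — `f ∈ 𝔪ᵐ ⇒ f/xᵐ ∈ A` (the STRICT TRANSFORM of `f` when `m = ord f`); `chartIncl_eq_pow_mul_divPow`;
  `not_dvd_divPow` — for `R` two-dimensional regular and `f ∉ 𝔪ᵐ⁺¹`: `x ∤ f/xᵐ` in `A` (powers of `𝔪` are contracted from `A`).
* **`chartLift θ`** `: A →+* L` — the unique ring map with `chartLift ∘ chartIncl = θ` and `chartLift (y/x) = θ y / θ x`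
  (well defined: if `P(y/x) = 0` then `(scaleRoots P x)(y) = 0` in `R`, so `θ x ^ deg P · P^θ(θ y/θ x) = 0`);
  `chartLift_chartIncl`, `chartLift_div`.
* **`ker_chartLift`** — for `R` two-dimensional regular, `ker θ = (f)`, `f ∈ 𝔪ᵐ ∖ 𝔪ᵐ⁺¹`: **`ker (chartLift θ) = (f/xᵐ) A`**
  (`⊇`: `θ f = 0`; `⊆`: `xⁿ a = b ∈ R` with `θ b = 0`, so `b = c f = c xᵐ (f/xᵐ)`, and `x` is a prime of `A` not dividing `f/xᵐ`).

References: M. Herrmann, S. Ikeda, U. Orbanz, *Equimultiplicity and Blowing up* (1988), Ch. II and Thm. (30.2) [HerrmannIkedaOrbanz1988];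
C. Huneke, I. Swanson (2006), §14.2 [HunekeSwanson2006]; O. Zariski, P. Samuel II, App. 5 [ZariskiSamuel1960].
-/

noncomputable section

set_option linter.dupNamespace false -- mandated namespace of this single-conjunct summit

open IsLocalRing Polynomial Literature.AlgebraicGeometry.Resolution

namespace Summit.ResolutionOfSingularities.ResolutionOfSingularities.Theorems.SigmaMaxModificationsCorridor3.TameLowSnc

universe u v

variable {K : Type u} [Field K]

/-! ## §1 The strict transform `f/xᵐ` on the chart `R[y/x]` -/

section Strict

variable {R : Subring K} [IsLocalRing R] {x y : R}

/-- `f ∈ 𝔪ᵐ ⇒ f/xᵐ ∈ R[y/x]` (`𝔪ᵐ R[y/x] = xᵐ R[y/x]`). [OURS · proved; Huneke–Swanson §14.2] -/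
theorem div_pow_mem_chartAdjoin (hm : maximalIdeal R = Ideal.span {x, y}) (hx0 : x ≠ 0) {f : R} {m : ℕ}
    (hf : f ∈ maximalIdeal R ^ m) : ((f : R) : K) / ((x : R) : K) ^ m ∈ chartAdjoin (K := K) x y := by
  have hx0K : ((x : R) : K) ≠ 0 := fun e => hx0 (Subtype.ext e)
  have h := map_chartIncl_le_span_pow (K := K) hm hx0 (J := Ideal.span {f}) (r := m)
    ((Ideal.span_singleton_le_iff_mem _).mpr hf) (Ideal.mem_map_of_mem _ (Ideal.mem_span_singleton_self f))
  obtain ⟨a, ha⟩ := Ideal.mem_span_singleton'.mp h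
  have e : ((f : R) : K) / ((x : R) : K) ^ m = (a : K) := by
    rw [div_eq_iff (pow_ne_zero _ hx0K)]
    have := congrArg (fun t : chartAdjoin (K := K) x y => (t : K)) ha
    simp only [Subring.coe_mul, SubmonoidClass.coe_pow] at this
    exact this.symm
  rw [e]; exact a.2

/-- `chartIncl f = (chartIncl x)ᵐ · (f/xᵐ)` in `R[y/x]`. [OURS · proved] -/
theorem chartIncl_eq_pow_mul_divPow (hm : maximalIdeal R = Ideal.span {x, y}) (hx0 : x ≠ 0) {f : R} {m : ℕ}
    (hf : f ∈ maximalIdeal R ^ m) :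
    chartIncl (K := K) x y f = chartIncl x y x ^ m * ⟨_, div_pow_mem_chartAdjoin hm hx0 hf⟩ := by
  have hx0K : ((x : R) : K) ≠ 0 := fun e => hx0 (Subtype.ext e)
  apply Subtype.ext
  change ((f : R) : K) = ((x : R) : K) ^ m * (((f : R) : K) / ((x : R) : K) ^ m)
  rw [mul_div_cancel₀ _ (pow_ne_zero _ hx0K)]

end Strict

section StrictRegular

variable {R : Subring K} [IsRegularLocalRing R] {x y : R}

/-- **`x ∤ f/xᵐ` in `R[y/x]` when `f ∉ 𝔪ᵐ⁺¹`** (`R` two-dimensional regular): else `f ∈ xᵐ⁺¹ R[y/x] ∩ R = 𝔪ᵐ⁺¹`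
(`comap_map_pow_maximalIdeal`). [OURS · proved; Zariski–Samuel II App. 5] -/
theorem not_dvd_divPow (hdim : ringKrullDim R = 2) (hm : maximalIdeal R = Ideal.span {x, y}) {f : R} {m : ℕ}
    (hf : f ∈ maximalIdeal R ^ m) (hf' : f ∉ maximalIdeal R ^ (m + 1)) :
    ¬ chartIncl (K := K) x y x ∣ ⟨_, div_pow_mem_chartAdjoin hm (fun h => fst_not_mem_sq hdim hm (h ▸ Ideal.zero_mem _)) hf⟩ := by
  have hx0 : x ≠ 0 := fun h => fst_not_mem_sq hdim hm (h ▸ Ideal.zero_mem _)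
  rintro ⟨a, ha⟩
  letI : Algebra R (chartAdjoin (K := K) x y) := (chartIncl x y).toAlgebra
  have halg : algebraMap R (chartAdjoin (K := K) x y) = chartIncl x y := rfl
  have hxm : x ∈ maximalIdeal R := hm ▸ Ideal.subset_span (by simp)
  have hx2 := fst_not_mem_sq hdim hm
  have hmS : (maximalIdeal R).map (algebraMap R (chartAdjoin (K := K) x y)) =
      Ideal.span {algebraMap R _ x} := map_maximalIdeal_chartIncl hm hx0
  have hS2 := exists_pow_mul_eq_chartIncl (K := K) hm hx0
  apply hf'
  have h1 : chartIncl (K := K) x y f ∈ (maximalIdeal R ^ (m + 1)).map (chartIncl x y) := by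
    rw [chartIncl_eq_pow_mul_divPow hm hx0 hf, ha, ← mul_assoc, ← pow_succ, Ideal.map_pow,
      map_maximalIdeal_chartIncl hm hx0, Ideal.span_singleton_pow]
    exact Ideal.mul_mem_right _ _ (Ideal.mem_span_singleton_self _)
  have h2 : f ∈ ((maximalIdeal R ^ (m + 1)).map (chartIncl (K := K) x y)).comap (chartIncl x y) := h1
  rwa [← halg, comap_map_pow_maximalIdeal hxm hx2 (chartIncl_injective x y) hmS hS2 (m + 1)] at h2

end StrictRegular

/-! ## §2 The chart of the branch: `chartLift θ : R[y/x] → L` -/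

section Lift

variable {R : Subring K} {x y : R} {L : Type v} [Field L]

/-- The kernel condition: if `P(y/x) = 0` in `K` then `P^θ(θ y / θ x) = 0` in `L` (clear denominators with `scaleRoots P x`, map by
`θ`, divide by `θ x ^ deg P`). [OURS · proved] -/
theorem eval₂_eq_zero_of_aeval_div_eq_zero (hx0 : x ≠ 0) (θ : R →+* L) (hθx : θ x ≠ 0) {P : R[X]}
    (hP : aeval (((y : R) : K) / ((x : R) : K)) P = 0) : eval₂ θ (θ y / θ x) P = 0 := by
  have hx0K : ((x : R) : K) ≠ 0 := fun e => hx0 (Subtype.ext e)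
  -- `(scaleRoots P x)(y) = 0` in `R`
  have h1 : eval₂ (algebraMap R K) ((y : R) : K) (scaleRoots P x) = 0 := by
    have e : algebraMap R K x * (((y : R) : K) / ((x : R) : K)) = ((y : R) : K) := by
      change ((x : R) : K) * _ = _
      rw [mul_div_cancel₀ _ hx0K]
    rw [← e, scaleRoots_eval₂_mul, ← aeval_def, hP, mul_zero]
  have h2 : eval ( y) (scaleRoots P x) = 0 := by
    have e : eval₂ (algebraMap R K) ((y : R) : K) (scaleRoots P x) = algebraMap R K (eval y (scaleRoots P x)) :=
      eval₂_hom (algebraMap R K) y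
    rw [e] at h1
    exact Subtype.ext h1
  -- map by `θ`
  have h3 : eval₂ θ (θ y) (scaleRoots P x) = 0 := by rw [eval₂_hom, h2, map_zero]
  have e : θ x * (θ y / θ x) = θ y := mul_div_cancel₀ _ hθx
  rw [← e, scaleRoots_eval₂_mul] at h3
  exact (mul_eq_zero.mp h3).resolve_left (pow_ne_zero _ hθx)

/-- The co-restricted evaluation `R[X] → R[y/x]`. [OURS · bookkeeping] -/
abbrev aevalChart (x y : R) : R[X] →+* chartAdjoin (K := K) x y :=
  (aeval (((y : R) : K) / ((x : R) : K))).toRingHom.codRestrict _ fun _ => aeval_mem_adjoin_singleton R _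

/-- `aevalChart` is surjective. [OURS · proved] -/
theorem aevalChart_surjective (x y : R) : Function.Surjective (aevalChart (K := K) x y) :=
  aevalCod_surjective R _ _

/-- **The chart of the branch**: the ring map `chartLift θ : R[y/x] → L` extending `θ : R → L` by `y/x ↦ θ y / θ x`
(lift through the surjection `R[X] → R[y/x]`). [OURS · L1 W4.2 bookkeeping; Herrmann–Ikeda–Orbanz Ch. II] -/
def chartLift (hx0 : x ≠ 0) (θ : R →+* L) (hθx : θ x ≠ 0) : chartAdjoin (K := K) x y →+* L :=
  (aevalChart (K := K) x y).liftOfSurjective (aevalChart_surjective x y)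
    ⟨eval₂RingHom θ (θ y / θ x), fun P hP => by
      rw [RingHom.mem_ker] at hP ⊢
      exact eval₂_eq_zero_of_aeval_div_eq_zero hx0 θ hθx (congrArg Subtype.val hP)⟩

/-- `chartLift θ (P(y/x)) = P^θ(θ y/θ x)`. [OURS · proved] -/
theorem chartLift_aevalChart (hx0 : x ≠ 0) (θ : R →+* L) (hθx : θ x ≠ 0) (P : R[X]) :
    chartLift (K := K) hx0 θ hθx (aevalChart x y P) = eval₂ θ (θ y / θ x) P :=
  RingHom.liftOfSurjective_comp_apply _ _ _ P

/-- `chartLift θ ∘ chartIncl = θ`. [OURS · proved] -/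
theorem chartLift_chartIncl (hx0 : x ≠ 0) (θ : R →+* L) (hθx : θ x ≠ 0) (r : R) :
    chartLift (K := K) hx0 θ hθx (chartIncl x y r) = θ r := by
  have e : chartIncl (K := K) x y r = aevalChart x y (C r) := Subtype.ext (by
    change (r : K) = aeval _ (C r)
    rw [aeval_C]; rfl)
  rw [e, chartLift_aevalChart, eval₂_C]

/-- `chartLift θ (y/x) = θ y / θ x`. [OURS · proved] -/
theorem chartLift_div (hx0 : x ≠ 0) (θ : R →+* L) (hθx : θ x ≠ 0)
    (h : ((y : R) : K) / ((x : R) : K) ∈ chartAdjoin (K := K) x y) :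
    chartLift (K := K) hx0 θ hθx ⟨_, h⟩ = θ y / θ x := by
  have e : (⟨_, h⟩ : chartAdjoin (K := K) x y) = aevalChart x y X := Subtype.ext (by
    change _ = aeval _ X
    rw [aeval_X])
  rw [e, chartLift_aevalChart, eval₂_X]

end Lift

/-! ## §3 The kernel of the chart of the branch is generated by the strict transform -/

section Kernel

variable {R : Subring K} [IsRegularLocalRing R] {x y : R} {L : Type v} [Field L]

/-- **`ker (chartLift θ) = (f/xᵐ)`** for `R` two-dimensional regular with `𝔪 = (x, y)`, `ker θ = (f)`, `f ∈ 𝔪ᵐ ∖ 𝔪ᵐ⁺¹`: the strict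
transform of the branch `V(f)` on the chart `R[y/x]` is cut out by `f/xᵐ`, and the chart of the blown-up branch is `R[y/x]/(f/xᵐ)`.
[OURS · proved; Herrmann–Ikeda–Orbanz Ch. II (12.12)–(12.14), Thm. (30.2)] -/
theorem ker_chartLift (hdim : ringKrullDim R = 2) (hm : maximalIdeal R = Ideal.span {x, y}) (θ : R →+* L)
    (hθx : θ x ≠ 0) {f : R} (hker : RingHom.ker θ = Ideal.span {f}) {m : ℕ} (hf : f ∈ maximalIdeal R ^ m)
    (hf' : f ∉ maximalIdeal R ^ (m + 1)) :
    RingHom.ker (chartLift (K := K) (fun h => fst_not_mem_sq hdim hm (h ▸ Ideal.zero_mem _)) θ hθx) =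
      Ideal.span {⟨_, div_pow_mem_chartAdjoin hm (fun h => fst_not_mem_sq hdim hm (h ▸ Ideal.zero_mem _)) hf⟩} := by
  have hx0 : x ≠ 0 := fun h => fst_not_mem_sq hdim hm (h ▸ Ideal.zero_mem _)
  set f₁ : chartAdjoin (K := K) x y := ⟨_, div_pow_mem_chartAdjoin hm hx0 hf⟩ with hf₁
  have hfx : chartIncl (K := K) x y f = chartIncl x y x ^ m * f₁ := chartIncl_eq_pow_mul_divPow hm hx0 hf
  have hθf : θ f = 0 := by
    have : f ∈ RingHom.ker θ := hker ▸ Ideal.mem_span_singleton_self f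
    exact this
  apply le_antisymm
  · intro a ha
    rw [RingHom.mem_ker] at ha
    -- `xⁿ a = b ∈ R`
    obtain ⟨n, b, -, hb⟩ := exists_pow_mul_eq_chartIncl (K := K) hm hx0 a
    have hθb : θ b = 0 := by
      rw [← chartLift_chartIncl (K := K) hx0 θ hθx b, hb, map_mul, ha, mul_zero]
    have hbker : b ∈ RingHom.ker θ := hθb
    rw [hker, Ideal.mem_span_singleton'] at hbker
    obtain ⟨c, rfl⟩ := hbker
    -- `xⁿ a = c xᵐ f₁` in the domain `A`, with `x` prime and `x ∤ f₁`
    rw [map_mul, hfx] at hb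
    have hm' : maximalIdeal R = Ideal.span {y, x} := by rw [hm, Ideal.span_pair_comm]
    obtain ⟨hxp, hxy, -, -⟩ := prime_and_not_dvd_of_span_pair hdim hm'
    have hxm : x ∈ maximalIdeal R := hm ▸ Ideal.subset_span (by simp)
    have hym : y ∈ maximalIdeal R := hm ▸ Ideal.subset_span (by simp)
    have hpq : ∀ t, x ∣ y * t → x ∣ t := fun t ht => (hxp.dvd_or_dvd ht).resolve_left hxy
    have hprime : Prime (chartIncl (K := K) x y x) := by
      have h𝔭 : ((maximalIdeal R).map (chartIncl (K := K) x y)).IsPrime := isPrime_map_incl (K := K) hx0 hpq hxm hym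
      rw [map_maximalIdeal_chartIncl hm hx0] at h𝔭
      exact (Ideal.span_singleton_prime (fun h => hx0 (chartIncl_injective x y (by rw [h, map_zero])))).mp h𝔭
    have hndvd := not_dvd_divPow (K := K) hdim hm hf hf'
    rw [Ideal.mem_span_singleton]
    rcases le_or_gt n m with hnm | hmn
    · -- `a = c x^{m-n} f₁`
      obtain ⟨k, rfl⟩ := Nat.exists_eq_add_of_le hnm
      refine ⟨chartIncl x y c * chartIncl x y x ^ k, ?_⟩
      have h0 : chartIncl (K := K) x y x ^ n ≠ 0 := pow_ne_zero _ hprime.ne_zero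
      apply mul_left_cancel₀ h0
      linear_combination (-1 : chartAdjoin (K := K) x y) * hb
    · -- `x^{n-m} a = c f₁`, so `x^{n-m} ∣ c`
      obtain ⟨k, rfl⟩ := Nat.exists_eq_add_of_lt hmn
      have h0 : chartIncl (K := K) x y x ^ m ≠ 0 := pow_ne_zero _ hprime.ne_zero
      have hb' : chartIncl (K := K) x y x ^ (k + 1) * a = chartIncl x y c * f₁ := by
        apply mul_left_cancel₀ h0
        linear_combination (-1 : chartAdjoin (K := K) x y) * hb
      have hdvd : chartIncl (K := K) x y x ^ (k + 1) ∣ chartIncl x y c * f₁ := ⟨a, hb'.symm⟩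
      obtain ⟨c', hc'⟩ := hprime.pow_dvd_of_dvd_mul_right (k + 1) hndvd hdvd
      refine ⟨c', ?_⟩
      have h0' : chartIncl (K := K) x y x ^ (k + 1) ≠ 0 := pow_ne_zero _ hprime.ne_zero
      apply mul_left_cancel₀ h0'
      linear_combination hb' + f₁ * hc'
  · rw [Ideal.span_singleton_le_iff_mem, RingHom.mem_ker]
    have h := congrArg (chartLift (K := K) hx0 θ hθx) hfx
    rw [chartLift_chartIncl, hθf, map_mul, map_pow, chartLift_chartIncl] at h
    exact (mul_eq_zero.mp h.symm).resolve_left (pow_ne_zero _ hθx)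

end Kernel

end Summit.ResolutionOfSingularities.ResolutionOfSingularities.Theorems.SigmaMaxModificationsCorridor3.TameLowSnc

end
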